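import Summits.CriticalPhenomena.PercolationContinuityZ3.Theorems.PercNearOneGluingNoHeavyLowerTailCovTauA2EdgeAnti
import Summits.CriticalPhenomena.PercolationContinuityZ3.Theorems.PercNearOneGluingNoHeavyLowerTailCovTauBridge
import HarnessLib

/-!
# Crux `NoHeavyLowerTail` (stmt-CriticalPhenomena-4575): COV(τ) from the one-source bounds

Support file (`--supports stmt-CriticalPhenomena-4575`, prover prim-hp-4 gen 9).  No named facts, no sorries, no
`Prop` definitions.

The Lean chain of the conditioned covariance transfer COV(τ) (prim-hp-8's COV-TAU-PROOF; ⇒ (S5)₂ ⇒ (GEN) for three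
relays ⇒ Kozma–Nitzan's Conjecture 1 for `|A| = 3` through `CovTau.covTransfer_of_covTau`,
`SurplusTransfer.surplusTransfer_pair_of_covTransfer`, `SurplusTransfer.gen_triple_of_covTransfer`):
* `CovTau.p1E` (prim-hp-4, `…CovTauA2EdgeAnti.lean`): the sum-form diagonal `E({y})·Y({y}) ≤ M({y})·X({y})` (P1 ≥ 0)
  from the two-source induction (A2) of COV-TAU-PROOF §4, MODULO the one-source bounds (★_N) and (Y ≤ B);
* `CovTau.covTau_of_sumForm` (prim-gen-induct, `…CovTauBridge.lean` + `…CovTauAssembly.lean`): COV(τ) from that sum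
  form (two-cluster Gibbs-sampler reduction, world-wise 4PT, closure over degenerate weights).
THIS FILE composes them: **`CovTau.covTau_of_oneSource`** — COV(τ) for every weight `w` and every monotone functional of
the open edge cluster, assuming only (★_N) `Y_{U'}(N)·M_{U'}(∅) ≤ M_{U'}(N)·B_{U'}` and (Y ≤ B) `Y_{U'}({u}) ≤ B_{U'}`
in every vertex set `U'` for all non-degenerate weights and all monotone `g ≥ 0` (functionals `CovTau.YfE/Mf/BfE`) —
the two one-source consequences of the decision-tree Harris inequality [Gladkov2024, Thm. 3.2] and vdBHK Thm. 1.4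
(COV-TAU-PROOF §3; tree: `CovTauStarN.starN_ED`, prim-ineq-prove-1, in the finitary `ED` calculus — the adapter to
the present vocabulary is the last open link).
[cite: VandenbergHaggstromKahn2005, Thm. 1.1 (pp. 3–5), §2.1 (pp. 9–13)] [cite: Gladkov2024, Thm. 3.2]
[cite: KozmaNitzan2024, Conj. 1 (p. 3)]
-/

noncomputable section

namespace Summit.CriticalPhenomena.PercolationContinuityZ3.Theorems.CovTau

open MeasureTheory
open Literature.Probability.LatticeModels (prodBernoulli)
open Literature.Probability.Percolation
open Literature.Probability.Percolation.BHK2006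
open scoped Classical

variable {V : Type*} [Fintype V]

/-- **COV(τ) from the one-source bounds.**  For owner `x`, avoided vertex `y`, observers `o` and `v ≠ x`: IF for every
non-degenerate weight `p`, every monotone `g ≥ 0` on edge sets and every `U' : Finset V`
(★_N) `YfE·Mf(∅) ≤ Mf(N)·BfE` for all `N ⊆ U'` and (Y ≤ B) `YfE({u}) ≤ BfE` for all `u`, THEN for every weight `w` and
every monotone `f`, with `D = {x ↮ y}`:
`μ(v↮x, v↮y, v↔o)·[μ(D) ∫_{D∩{x↔v}} f(C_x) − (∫_D f(C_x)) μ(D∩{x↔v})] ≤ μ(v↮x, v↮y)·[μ(D) ∫_{D∩{x↔o}} f(C_x) − (∫_D f(C_x)) μ(D∩{x↔o})]`,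
i.e. `Cov(f(C_x), 1{x↔o} | x↮y) ≥ μ(v↔o | v↮x, v↮y)·Cov(f(C_x), 1{x↔v} | x↮y)`.
Proof: `CovTau.covTau_of_sumForm` applied to `CovTau.p1E` at `U = univ`.
[cite: VandenbergHaggstromKahn2005, Thm. 1.1 (pp. 3–5), §2.1 (pp. 9–13)] [cite: Gladkov2024, Thm. 3.2]
[cite: KozmaNitzan2024, Conj. 1 (p. 3)] -/
theorem covTau_of_oneSource (w : Sym2 V → unitInterval) (x y o v : V) (hvx : v ≠ x)
    (hstar : ∀ p : Sym2 V → unitInterval, (∀ e, 0 < p e ∧ p e < 1) →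
      ∀ g : Set (Sym2 V) → ℝ, Monotone g → (∀ C, 0 ≤ g C) →
      ∀ U' : Finset V, ∀ N : Set V, N ⊆ ↑U' →
        YfE (fun e => (p e : ℝ)) U' x v g N * Mf (fun e => (p e : ℝ)) U' x v ∅ ≤
          Mf (fun e => (p e : ℝ)) U' x v N * BfE (fun e => (p e : ℝ)) U' x v g)
    (hYB : ∀ p : Sym2 V → unitInterval, (∀ e, 0 < p e ∧ p e < 1) →
      ∀ g : Set (Sym2 V) → ℝ, Monotone g → (∀ C, 0 ≤ g C) →
      ∀ U' : Finset V, ∀ u : V,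
        YfE (fun e => (p e : ℝ)) U' x v g {u} ≤ BfE (fun e => (p e : ℝ)) U' x v g)
    (f : Set (Sym2 V) → ℝ) (hf : Monotone f) :
    (prodBernoulli w).real ({ω : BondConfig V | ¬ (openGraph ω).Reachable v x} ∩
          {ω | ¬ (openGraph ω).Reachable v y} ∩ openConn v o) *
        ((prodBernoulli w).real {ω : BondConfig V | ¬ (openGraph ω).Reachable x y} *
            (∫ ω in {ω : BondConfig V | ¬ (openGraph ω).Reachable x y} ∩ openConn x v,
              f (openEdgeCluster ω x) ∂(prodBernoulli w)) -
          (∫ ω in {ω : BondConfig V | ¬ (openGraph ω).Reachable x y},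
              f (openEdgeCluster ω x) ∂(prodBernoulli w)) *
            (prodBernoulli w).real ({ω : BondConfig V | ¬ (openGraph ω).Reachable x y} ∩ openConn x v)) ≤
      (prodBernoulli w).real ({ω : BondConfig V | ¬ (openGraph ω).Reachable v x} ∩
          {ω | ¬ (openGraph ω).Reachable v y}) *
        ((prodBernoulli w).real {ω : BondConfig V | ¬ (openGraph ω).Reachable x y} *
            (∫ ω in {ω : BondConfig V | ¬ (openGraph ω).Reachable x y} ∩ openConn x o,
              f (openEdgeCluster ω x) ∂(prodBernoulli w)) -
          (∫ ω in {ω : BondConfig V | ¬ (openGraph ω).Reachable x y},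
              f (openEdgeCluster ω x) ∂(prodBernoulli w)) *
            (prodBernoulli w).real ({ω : BondConfig V | ¬ (openGraph ω).Reachable x y} ∩ openConn x o)) := by
  refine covTau_of_sumForm w x y o v hvx (fun p hp g hg hg0 => ?_) f hf
  have hw0 : ∀ e, 0 ≤ (fun e => (p e : ℝ)) e := fun e => (p e).2.1
  have hw1 : ∀ e, (fun e => (p e : ℝ)) e ≤ 1 := fun e => (p e).2.2
  exact p1E (fun e => (p e : ℝ)) hw0 hw1 (sum_weight_coe_eq_one p) x o v y hg hg0 (Finset.univ : Finset V)
    (Finset.mem_univ y) (fun U' _ N hN => hstar p hp g hg hg0 U' N hN) (fun U' _ u => hYB p hp g hg hg0 U' u)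

end Summit.CriticalPhenomena.PercolationContinuityZ3.Theorems.CovTau
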